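import Mathlib
import HarnessLib
import HarnessLib.Audit
import Summits.AtomisticToContinuum.Statement
import Literature.Geometry.DiscreteGeometry.FejesTothKissingTwelve
import Literature.MathematicalPhysics.StatisticalMechanics.BarlowStacking
import Literature.MathematicalPhysics.StatisticalMechanics.HaggStacking

/-!
Route: AdhesiveTailRung

CLOSED (retired) 2026-08-15T13:38:21Z by operator:999:1257524 — reason: not-a-thesis: assembly does not conclude the sub-problem Statement — note: D-0027 §2.1 audit (human 2026-08-15: routes that do not decide the summit are removed): the assembly concludes `Literature.MathematicalPhysics.StatisticalMechanics.Crystallization`, not the sub-problem statement; a NEW conforming route may be opened from the same idea (generated `closes : … → _root_. The file is kept as the record of this route; refuted decls are indexed as negative knowledge (`ledger negatives`).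

# Route AdhesiveTailRung — Radin's soft discs in R^3 — adhesive unit spheres + a weak completely
monotone tail crystallize onto hcp, booked without truncation (rung; LJ bridge open)

RUNG ROUTE realising card adhesive-spheres-weak-cm-tail (Radin1981's soft-disc theorem one dimension
up). X = AdhesiveTailCrystallizes:
for the pair potential V_{s,δ,M}(r) = M (r < 1), −1 − δ (r = 1), −δ r^{−s} (r > 1) in ℝ³ with s > 4,
0 < δ < δ₀(s) and wall M ≥ M₀,
and granting the two computer-assisted Hales facts flyspeck_L12 and Hales2012_kissingConfigCongruent
as hypotheses, BOTH Blanc–Lewin conjuncts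
hold with the minimiser NAMED: hcp (contact 1, ideal spacing √(2/3)) is a least element of the
energy per particle over all periodic
configurations, E(N)/N → e(hcp), and IsCrystallizing V 3. Kepler/kissing geometry leaves the
stacking free; the weak attractive completely
monotone tail decides it (hcp, per site, with a strict gap), and the tail is booked WITHOUT
truncation: cross-interface r^{−s} mass is
O(#defects) exactly when s > 4. The LJ conjunct is reached only through the explicitly OPEN bridge
item AdhesiveToLennardJones (rung route: this
route does NOT claim the summit); the deliverables are the engines BarlowRegionEmbedding /
TruncationFreeTailBound / PerSiteHcpOptimality, reusable verbatim by the
LJ routes (CrystalKissingRigidity.StackingFaultBound,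
PoissonBesselStacking.LjRegistryDomination/HcpEnergyMinOnBox, CrystalThreeCone.SlackToBulk),
and the first 3-D Blanc–Lewin-type theorem whose selector is a physical infinite-range pair tail.
Lean: `∀ s : ℝ, 4 < s → ∃ δ₀ : ℝ, 0 < δ₀ ∧ ∀ δ : ℝ, 0 < δ → δ < δ₀ → ∃ M₀ : ℝ, ∀ M : ℝ, M₀ ≤ M →
Literature.Geometry.DiscreteGeometry.flyspeck_L12 →
Literature.Geometry.DiscreteGeometry.Hales2012_kissingConfigCongruent → ∀ (h1 : (1 : ℝ) ≠ 0) (hh :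
Real.sqrt (2 / 3) ≠ 0), (IsLeast (Set.range fun Q :
Literature.MathematicalPhysics.StatisticalMechanics.PeriodicConfiguration 3 => Q.energyPerParticle
(fun r : ℝ => if r < 1 then M else -(if r = 1 then (1 : ℝ) else 0) - δ * r ^ (-s)))
((Literature.MathematicalPhysics.StatisticalMechanics.hcpPeriodicConfiguration h1
hh).energyPerParticle (fun r : ℝ => if r < 1 then M else -(if r = 1 then (1 : ℝ) else 0) - δ * r ^
(-s))) ∧ Filter.Tendsto (fun N : ℕ =>
Literature.MathematicalPhysics.StatisticalMechanics.groundStateEnergy (fun r : ℝ => if r < 1 then M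
else -(if r = 1 then (1 : ℝ) else 0) - δ * r ^ (-s)) 3 N / N) Filter.atTop (nhds
((Literature.MathematicalPhysics.StatisticalMechanics.hcpPeriodicConfiguration h1
hh).energyPerParticle (fun r : ℝ => if r < 1 then M else -(if r = 1 then (1 : ℝ) else 0) - δ * r ^
(-s))))) ∧ Literature.MathematicalPhysics.StatisticalMechanics.IsCrystallizing (fun r : ℝ => if r <
1 then M else -(if r = 1 then (1 : ℝ) else 0) - δ * r ^ (-s)) 3`

## Assembly
Pure logic given the bridge: AdhesiveTailCrystallizes and AdhesiveToLennardJones give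
Crystallization (`fun h b => b h`, checked in
Sketch.lean). The mathematical assembly of the RUNG is RungGlue (cruxes 5, 6 + supports ⇒ target);
cruxes 2–4 feed crux 5/6 through the
foreseen splits below. HONESTY CLAUSE: AdhesiveToLennardJones is an open bridge with no claimed
mechanism — closing every crux proves the rung
theorem and lands the three engines; it does not close the LJ conjunct (the conditional-bridge flag
is not used because the bridge is not a
named published conjecture).

Rationale: WHY THIS LINE. Mechanism (menu: toy-model ladder + pass to the exact limit): at the adhesive corner
every geometric step is EXACT — a ground state is a unit
packing, contacts number ≤ 6N with deficiency D = Σ(12 − c_i) (kissing ≤ 12 from flyspeck_L12,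
CountingSpheres.card_le_twelve_of_flyspeck_L12),
a 12-kissed ball with 12-kissed neighbours has an exact cuboctahedral/anticuboctahedral shell
(Hales2012 Thm 1 via hales2012_separation_of_L12 +
Hales2012_kissingConfigCongruent) and connected deep regions are fragments of ONE Barlow stacking
(HalesDSP2012 §1.3, LayerStackings.lean, here in
region form) — so the only analysis is tail bookkeeping, done by EXTENSION COMPARISON inside regions
(drop exterior terms of the infinite
stacking, per-site hcp optimality for completely monotone weights: theta domination θ_Λ ≥ θ_{Λ+w} by
Poisson summation as in BeterminPetrache2017
Prop./Step 2.3, plus monotone pairing of aligned layer distances k_j ≥ 2j) and SEGMENT CHARGING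
across regions (flux of r^{−s} bonds through an
interface is finite iff s > 4; first-moment folklore, cf. KubinPonsiglione2021 for the
non-integrable regime). Imported areas: discrete
geometry of kissing configurations (Flyspeck/Hales, formally verified in HOL Light), lattice theta
functions (analytic number theory side of
BeterminPetrache2017), sticky-limit crystallization (HeitmannRadin1980, Radin1981, in tree for d =
1: StickyChainCrystallization.lean). What it
does that prior routes do not: CrystalKissingRigidity / CrystalThreeCone / PoissonBesselStacking
attack LJ directly and all stall on an η > 0
rigidity or certificate step; this line proves an honest theorem at η = 0 with a PHYSICAL
infinite-range selector and isolates the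
truncation-free bookkeeping they will all need; nearest 3-D theorem FlatleyTheil2015 needs a
three-body term. Negatives index empty.

RANKED CRUXES. #0 AdhesiveTailCrystallizes (target) — for s > 4 there is δ₀ > 0 such that for 0 < δ
< δ₀ and M ≥ M₀(s, δ): flyspeck_L12 → Hales2012_kissingConfigCongruent → (hcpPeriodicConfiguration 1
√(2/3) is a least element of Q ↦ e_V(Q) over periodic Q ∧ E_V(N)/N → e_V(hcp)) ∧ IsCrystallizing V
3, for V = V_{s,δ,M} (card target, both conjuncts, minimiser named). (why it might fail: δ₀(s) may
be absurdly small (C″ ~ 10³ at s = 6 ⇒ δ₀ ~ 1e−4: true but physically silly); at δ = 0 conjunct (ii)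
is genuinely open (stacking degeneracy), so every estimate must carry the δ-slack explicitly.)
[Radin1981, HeitmannRadin1980, Hales2012, HalesDSP2012, BeterminPetrache2017, FlatleyTheil2015,
BlancLewin2015]
#2 BarlowRegionEmbedding (crux) — (card A2, region form) flyspeck_L12 →
Hales2012_kissingConfigCongruent → in a 1-separated set X ⊂ ℝ³, every non-empty contact-connected
set G of DEEP points (u deep: u and all its contact neighbours have exactly 12 contacts) lies in one
rigid image g(S) of a Barlow stacking S = barlowStacking 1 √(2/3) σ, and X agrees with g(S) on the
balls B(u, 1.26), u ∈ G. [difficulty: L] (why it might fail: Holonomy: a deep region that is not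
simply connected might close up around an exact 'dislocation loop' with a registry shift (and
all-fcc stretches carry 4 layer normals), so no single stacking contains it; the fallback (simply
connected pieces) leaks area terms into crux 3.) [Hales2012, HalesDSP2012, HalesEtAl2015,
KusnerKusnerLagariasShlosman2018 arXiv:1611.10297,
Literature.Barriers.AtomisticToContinuum.FlexibleKissingArrangements]
#3 TruncationFreeTailBound (crux) — (card A3, the new engine) for s > 4, granting the two Hales
facts, there is C(s) with Σ_{x≠y∈X} |x−y|^{−s} ≤ ζ_hcp(s)·|X| + C·#{non-deep points} for every
finite 1-separated X ⊂ ℝ³, ζ_hcp(s) = Σ_{y∈hcp∖0} ‖y‖^{−s} (contact 1): internal pairs of a deep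
region by extension comparison in its stacking (crux 2) + per-site hcp optimality (crux 4); cross
pairs charged to a non-deep point within 3 of the segment (routing walk + SegmentChargingBound).
[deps: BarlowRegionEmbedding, PerSiteHcpOptimality, SegmentChargingBound] [difficulty: L] (why it
might fail: No δN/log N leak only if deep regions embed in ONE stacking (crux 2) and every cross
pair's segment passes within 3 of a non-deep point; ball-by-ball charts provably lose Σ_k k²·k^{3−s}
= log N at s = 6, so the region form is essential, not cosmetic.) [Radin1981, KubinPonsiglione2021,
BeterminPetrache2017, BlancLewin2015 arXiv:1504.01153 §2.3]
#4 PerSiteHcpOptimality (crux) — (card A4) for s > 3 and ALL spacings a, h > 0 there is γ > 0 such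
that for every Hägg sequence σ and every site z of barlowStacking a h σ: Σ_{y∈S∖z} |y−z|^{−s} ≤
ζ_hcp(a,h,s), and ≤ ζ_hcp − γ unless the layers two above and two below z are aligned with z's layer
(h-letters on both sides) — aligned-minus-staggered layer sums g(kh) > 0 strictly decreasing (θ_Λ >
θ_{Λ+w} by Poisson, Bernstein in t²) + monotone pairing k_j ≥ 2j. [difficulty: L] (why it might
fail: Claimed for ALL (a,h), not only contact geometry, with a STRICT gap γ = g(2h) − g(3h): needs
θ_Λ(α) − θ_{Λ+w}(α) > 0 for every α (Poisson; Mathlib has only 1-D theta transforms); as typed it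
compares tsums whose summability (s > 3) must be threaded or junk zeros are compared.)
[BeterminPetrache2017 arXiv:1607.08716 Prop. 1.1 and Step 2.3, KiharaKoba1952,
BeterminSamajTravenec2022, Literature.MathematicalPhysics.StatisticalMechanics.barlowCoupling
(BarlowStackingEnergy.lean)]
#5 EnergyTwoSidedBound (crux) — for s > 4, 0 < δ < δ₀(s), M ≥ M₀, granting the Hales facts: |E_V(N)
− N·e_V(hcpPeriodicConfiguration 1 √(2/3))| ≤ K N^{2/3} for all N (lower bound: packing lemma +
kissing ≤ 12 + crux 3 with δ < 1/(13C); upper bound: hcp clusters, whose missing boundary tail is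
O(N^{2/3}) again iff s > 4). [deps: TruncationFreeTailBound, GroundStatesArePackings] [difficulty:
M] (why it might fail: Here a δN leak would surface: if cross-interface tail mass is not
O(#non-deep) (crux 2 or the routing false) the best bound is E(N) ≥ N e(hcp) − CδN and the hinge
dies; also needs energyPerParticle(hcp) identified with the layer sums (regrouping, cf.
BarlowEnergyIdentification).) [HeitmannRadin1980, Radin1981, Bezdek2012, BlancLewin2015,
Harborth1974]
#6 ExactHcpWindows (crux) — for s > 4, 0 < δ < δ₀(s), M ≥ M₀, granting the Hales facts: for every R
there is N₀ such that every ground state with N ≥ N₀ particles contains a particle x_i and a rigid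
motion g, g 0 = x_i, with {particles} ∩ B(x_i, R) = g(hcpStacking 1 √(2/3)) ∩ B(x_i, R) — exact hcp
windows (deficiency D ≤ K N^{2/3}, c-letter sites ≤ K N^{2/3}/(δγ) by the strict gap of crux 4,
pigeonhole, crux 2 on the clean ball). [deps: EnergyTwoSidedBound, BarlowRegionEmbedding,
PerSiteHcpOptimality] [difficulty: M] (why it might fail: Needs the per-SITE strict gap γδ to price
isolated c-layers; if selection only worked per layer PAIR (as for the repulsive twin, fcc) windows
would be 'hcp or twinned' and the ∃-window statement fails as typed; also N₀(R) ~ (K(1+1/δγ))³R⁹ —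
fine but huge.) [Radin1981, Hales2012, BeterminPetrache2017, PartayOrtnerCsanyi2017
arXiv:1705.01751, Literature.Barriers.AtomisticToContinuum.KissingTwelveDegeneracy]
#9 GroundStatesArePackings (support) — (card A1) for s > 3, 0 ≤ δ ≤ 1 there is M₀ (≈ 18 + 2δ Z′_s)
such that for M ≥ M₀, granting flyspeck_L12 (kissing ≤ 12), every ground state of V_{s,δ,M} has all
mutual distances ≥ 1: thin a configuration to a maximal packing sub-configuration Y; each removed
particle costs ≥ M − 12 − δZ′ against Y, the removed set has energy ≥ −(6 + δZ′/2)·# by induction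
(stability), and E(N) is non-increasing in N. [difficulty: provable-now] [HeitmannRadin1980,
BlancLewin2015 §1.2–1.3, Literature.MathematicalPhysics.StatisticalMechanics.StickyChain]
#9 SegmentChargingBound (support) — (card A3b, analytic half) for s > 4 there is C(s) such that for
every finite 1-separated X ⊂ ℝ³ and every point p, the total weight |x−y|^{−s} of ordered pairs of X
whose segment passes within distance 3 of p is ≤ C (pairs at combined distance u from p number O(u³)
by volume packing, LennardJonesClusters.card_le_of_separated_of_dist_le; Σ_u u³·u^{−s} < ∞ iff s >
4). [difficulty: provable-now] [KubinPonsiglione2021, BlancLewin2015,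
Literature.MathematicalPhysics.StatisticalMechanics.card_le_of_separated_of_dist_le]
#9 WindowsCrystallize (support) — (card A5) for any potential V whose ground states are 1-separated,
exact hcp windows of every radius in all large ground states imply IsCrystallizing V 3: centre at
the window, extract a convergent subsequence of the rotations in O(3), limit P = isometryImage A
(hcpPeriodicConfiguration 1 √(2/3)), m ≡ 1, convergence by
CrystallizationLocalLimit.tendsto_sum_of_eventually_near'. [difficulty: provable-now]
[BlancLewin2015 §2.1 (16),
Literature.MathematicalPhysics.StatisticalMechanics.PeriodicConfiguration.tendsto_sum_of_eventually_near',
Literature.MathematicalPhysics.StatisticalMechanics.PeriodicConfiguration.isometryImage]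
#9 PeriodicUpperBound (support) — periodic trial states: for s > 3, δ ≥ 0, M ≥ 0 and every periodic
configuration Q of ℝ³, eventually E_V(N)/N ≤ e_V(Q) + ε (boxes of Q; cross-boundary terms are either
+M, dropped in the right direction, or an absolutely summable tail o(N); surplus particles deleted
at cost o(N)). [difficulty: provable-now] [BlancLewin2015 §1.3 (8)–(9) and §2.1,
Literature.MathematicalPhysics.StatisticalMechanics.PeriodicConfigurationSums]
#9 RungGlue (support) — glue of the rung: GroundStatesArePackings → EnergyTwoSidedBound →
ExactHcpWindows → WindowsCrystallize → PeriodicUpperBound → AdhesiveTailCrystallizes (take δ₀ = min,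
M₀ = max; IsLeast from e(hcp) − K N^{−1/3} ≤ E(N)/N ≤ e(Q) + ε; Tendsto by squeeze with Q = hcp;
IsCrystallizing from the windows). [difficulty: provable-now] [BlancLewin2015]
#9 AdhesiveToLennardJones (support) — OPEN BRIDGE, NOT CLAIMED (rung route; this item is the honest
gap, cf. CMRescueSzpiro's rung pattern): the rung implies the Lennard-Jones conjunct. No mechanism
is asserted — LJ sits at well width O(1) and tail weight 2 in well units, far outside δ < δ₀, and
continuation in the potential (card potential-path-continuation) was retired for finite reach; the
item records the gap honestly so that the Assembly typechecks to the summit constant. Difficulty: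
open-problem; not to be staffed. [difficulty: open-problem] [BlancLewin2015 §2.3,
Literature.Barriers.AtomisticToContinuum.LocalizedPotentialsExcludeLennardJones]

TWO-LAYER PLAN. Foreseen glued splits (k ≤ 3, depth 1), filed only when a crux closes or stalls:
EnergyTwoSidedBound ⇐ ContactDeficiencyLowerBound (E ≥ N e(hcp) + (½ − 13δC)·D for packings) →
HcpClusterUpperBound (E(N) ≤ N e(hcp) + K N^{2/3}) → EnergyTwoSidedBound; ExactHcpWindows ⇐
DefectAndCLetterCount (D + δγ·#c-sites ≤ K N^{2/3}) → CleanBallIsHcp (crux 2 on a ball free of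
non-deep and c-sites ⇒ exact hcp window) → ExactHcpWindows; TruncationFreeTailBound ⇐ RoutingWalk
(cross pair ⇒ non-deep point within 3 of the segment) → ExtensionComparison →
TruncationFreeTailBound; BarlowRegionEmbedding ⇐ PaddedShellClassification (doubly 12-kissed ⇒ exact
fcc/hcp shell; η = 0, nearly in tree) → ChartContinuation (holonomy-free gluing along contact paths)
→ BarlowRegionEmbedding. Secondary target later (not filed): the REPULSIVE twin (+δ r^{−s})
crystallizes onto fcc by a reversed Hägg–Peierls count per layer pair (HaggDominationAllRanges
pattern).

KILL CRITERIA. Refutation of BarlowRegionEmbedding by an exact non-simply-connected deep region with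
non-trivial holonomy (an 'exact dislocation') closes the route as stated (close --reason
refuted:BarlowRegionEmbedding) unless the witness forces ≥ c·(area) non-12-kissed points, in which
case pivot: restate crux 2 for simply connected regions and crux 3 with an area term charged to
those points. Refutation of PerSiteHcpOptimality's strict gap (γ = 0 for some (a,h)) kills
ExactHcpWindows as typed (pivot to 'windows are hcp or twinned hcp', still periodic). A proof that
#non-deep = o(N) forces only E ≥ N e(hcp) − cδN (i.e. TruncationFreeTailBound false at s = 6) kills
the line outright — that is exactly the δN leak the card claims to remove. Proved elsewhere: nothing
moots a rung; if CrystalKissingRigidity.RobustFejesTothHales lands, crux 2 becomes its η = 0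
corollary.

NOT DECOMPOSED YET. Constants (δ₀(s), C(s) of segment charging with tube radius 3, Z′_s, M₀), the
identification energyPerParticle(hcp) = −6 − (δ/2)ζ_hcp(s) (layer regrouping), existence of ground
states for V_{s,δ,M} (l.s.c. energy + strict subadditivity; NOT needed for either conjunct, which
quantify over ground states / use inf), the in-layer translation invariance of site sums,
compactness of O(3) in WindowsCrystallize, and the repulsive-twin fcc statement — all layer-2
children or prover-side lemmas (--supports), deliberately not items now.

CHEAPEST FALSIFIER. (1) Compute C(6) of SegmentChargingBound and Z′_6 honestly (kit: lattice-free
volume bound Σ_{u≥1} (2u+7)³-type shell counts · u^{−6}) and hence δ₀(6) = 1/(26·C′): if δ₀ < 1e−4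
flag 'true but silly' (does not kill). (2) The killer lookup: is there an exact unit-sphere packing
fragment, contact-connected and doubly 12-kissed, that is NOT contained in a single Barlow packing
(a closed ring of coherent-twin-related fcc grains)? Products of twin reflections about a common
⟨110⟩ axis rotate by multiples of 2·arccos(1/3) ∉ πℚ, so no planar ring closes; a refuter should try
non-coaxial twin chains (5 minutes with exact arithmetic in ℚ(√2,√3)). Not run here: lean/kit time
went to typing the 13 items (all elaborate, Sketch.lean rc 0).

NUMBERS. Kissing number 12 and separation 2h₀ = 2.52 (radius-1 units; 1.26 at contact 1): Hales2012
Lemma 1–2, flyspeck_L12 (HOL Light verified, HalesEtAl2015). Contact numbers of N unit balls ≤ 6N −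
0.926 N^{2/3} (Bezdek2012; we only use ≤ 6N − ½D and the trivial hcp-cluster lower bound 6N −
O(N^{2/3})). ζ_hcp(6) = 14.4549 vs ζ_fcc(6) = 14.4539 (KiharaKoba1952; hcp − fcc ≈ +1.0e−3 of which
the k = 2 vs k = 3 layer term dominates); per-site gap at s = 6, contact geometry: γ = g(2h) − g(3h)
≈ 4e−4 (card estimate, uncertified). Interfacial threshold: Σ_{z∈Λ}|z|·|z|^{−s} < ∞ iff s > 4 (d =
3). Items at open: 13 (1 target, 5 cruxes, 6 support, 1 assembly).

DEFINITION REQUESTS. None blocking: the potential is written inline as `fun r => if r < 1 then M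
else -(if r = 1 then 1 else 0) - δ * r ^ (-s)` in every item (a named `adhesiveTailPotential s δ M`
in Literature/MathematicalPhysics/StatisticalMechanics would shorten the file; optional). All other
notions exist: barlowStacking, hcpStacking, hcpPeriodicConfiguration, barlowPos, IsHaggSeq,
HaggAligned (BarlowStacking/HaggStacking.lean), flyspeck_L12, Hales2012_kissingConfigCongruent,
hales_h0 (FejesTothKissingTwelve/FlyspeckL12.lean), IsCrystallizing, groundStateEnergy,
PeriodicConfiguration.energyPerParticle (Crystallization.lean). Bib: Bezdek2012 added (ledger bib
add, commit ac01f37689e8); Radin1981, KubinPonsiglione2021 present. Acquisition: Radin1981 full text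
paywalled, acq-02346.

Novelty: Searches (2026-08-15): `lit search --source crossref "ground state soft disks sticky potential
crystallization Radin"` (15: HeitmannRadin1980, Radin1981, GardnerRadin1979; nothing 3-D); `lit
search --source crossref "Flatley Theil face-centered cubic crystallization"` (FlatleyTheil2015
doi:10.1007/s00205-015-0862-1, three-body selector); `lit search --source crossref "Kubin
Ponsiglione attractive Riesz hard spheres"` (KubinPonsiglione2021 doi:10.1088/1361-6544/abcb06,
non-integrable tails, macroscopic shape only; CrismaleKubinNinnoPonsiglione2023
doi:10.1016/j.na.2022.113046 read pp. 2–3: failure of crystallization for UNSTABLE (q < 1, d = 1)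
Mie tails — outside s > 4); `lit search --hybrid --source local "sticky potential crystallization
hexagonal close packing kissing twelve"` (15 book hits: HalesDSP2012 pp. 16–18, ConwaySloane; no
theorem of this type); `lit frontier AtomisticToContinuum --since 2020` (30 rows; crystallization
rows arXiv:2604.19239 Kreutz–Ziereis 2026 read p. 1, 4, 34: rigid cell energies, Γ-limit to
polycrystals, not a pair potential; arXiv:2407.20762 2-D arbitrary norm); `lit galaxy search "sticky
spheres crystallization" --star all` (0 panama; pdf/crabby saturated), `lit galaxy search "adhesive
hard sphere" --star all` (8 panama physical-chemistry books: Baxter-model physics, no theorem);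
zbMATH 0 rows ×2; arXiv/OpenAlex rate-limited (429) this session; `ledger negatives` (0).
Nearest prior art found: Radin1981 doi:10.1007/bf01013177 (the model, d = 2:  [refs: 10.1007/s00205-015-0862-1, 10.1088/1361-6544/abcb06, 10.1016/j.na.2022.113046, 10.1007/bf01013177, 2604.19239, 2407.20762, 1209.6043, 1407.0692, 1607.08716, doi:10.1007/s00205-015-0862-1, doi:10.1088/1361-6544/abcb06, doi:10.1016/j.na.2022.113046, doi:10.1007/bf01013177, HeitmannRadin1980, Radin1981, GardnerRadin1979, FlatleyTheil2015, KubinPonsiglione2021, HalesDSP2012, Hales2012, BeterminPetrach]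

Barriers (technique_class: sticky-limit-exactness cm-tail-selection tail-bookkeeping): - technique_class: sticky-limit-exactness cm-tail-selection tail-bookkeeping
- Literature.Barriers.AtomisticToContinuum.KissingTwelveDegeneracy: APPLIES to cruxes 2/5 (contacts
give Barlow layers with an arbitrary Hägg word and equal contact energy); evaded by crux 4/6: the
completely monotone tail acts beyond √(8/3) with a definite per-site sign and a strict gap γδ, which
is what selects hcp — the barrier's own listed evasion, made quantitative.
- Literature.Barriers.AtomisticToContinuum.ShortRangeStackingBlindness: respected, not fought:
nothing of range < √(8/3) is asked to select; the selector is the infinite tail and it is never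
truncated (crux 3 exists precisely so that no finite-range surrogate is needed).
- Literature.Barriers.AtomisticToContinuum.FlexibleKissingArrangements: evaded by padding — a shell
is classified only when its twelve balls are themselves 12-kissed (Hales's separation Lemma 2 puts
it in the rigid class 𝒱); single soft shells are never classified (η = 0 throughout).
- Literature.Barriers.AtomisticToContinuum.StickySphereClusters: no finite-N exactness or uniqueness
is claimed; O(N^{2/3}) arbitrary defects are budgeted and only an ∃-window is extracted; icosahedral
13-clusters are catastrophic for contacts at η = 0 and live inside the budget.
- Literature.Barriers.AtomisticToContinuum.IcosahedralClusters: same — applies to LJ-like soft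
wells, not to exact contact counting; conceded that this is why the LJ bridge is open.
- Literature.Barriers.Atomist

History (route lifecycle, newest last):
- 2026-08-15T13:38:21Z · CLOSED retired — not-a-thesis: assembly does not conclude the sub-problem Statement (operator:999:1257524)

sub-problem: Crystallization · status: closed(retired) · opened planner-plancard-AtomisticToContinuum-Crystal-29198652-0 2026-08-15T11:44:52Z · rev 0 · ledger route-AtomisticToContinuum-AdhesiveTailRung
GENERATED by the gate from the ledger (D-0016/17). Provers cite these decls: `theorem foo : Summit.AtomisticToContinuum.Crystallization.Theses.AdhesiveTailRung.<Decl> := …` in Summits/AtomisticToContinuum/Crystallization/Theorems/<Name>.lean.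
-/

namespace Summit.AtomisticToContinuum.Crystallization.Theses.AdhesiveTailRung

open scoped BigOperators Topology Manifold Classical MeasureTheory ProbabilityTheory Matrix InnerProductSpace ComplexConjugate ContinuousMap
open Filter Set Function TopologicalSpace MeasureTheory

attribute [summit_statement] _root_.Crystallization

/-- item stmt-AtomisticToContinuum-6161 · target · rank 0 · closed · moot by None · by planner
why it might fail: δ₀(s) may be absurdly small (C″ ~ 10³ at s = 6 ⇒ δ₀ ~ 1e−4: true but physically silly); at δ = 0 conjunct (ii) is genuinely open (stacking degeneracy), so every estimate must carry the δ-slack explicitly.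
sources: Radin1981, HeitmannRadin1980, Hales2012, HalesDSP2012, BeterminPetrache2017, FlatleyTheil2015
[target] for s > 4 there is δ₀ > 0 such that for 0 < δ < δ₀ and M ≥ M₀(s, δ): flyspeck_L12 →
Hales2012_kissingConfigCongruent → (hcpPeriodicConfiguration 1 √(2/3) is a least element of Q ↦
e_V(Q) over periodic Q ∧ E_V(N)/N → e_V(hcp)) ∧ IsCrystallizing V 3, for V = V_{s,δ,M} (card target,
both conjuncts, minimiser named). -/
@[route_item "route-AtomisticToContinuum-AdhesiveTailRung"]
def AdhesiveTailCrystallizes : Prop :=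
  ∀ s : ℝ, 4 < s → ∃ δ₀ : ℝ, 0 < δ₀ ∧ ∀ δ : ℝ, 0 < δ → δ < δ₀ → ∃ M₀ : ℝ, ∀ M : ℝ, M₀ ≤ M → Literature.Geometry.DiscreteGeometry.flyspeck_L12 → Literature.Geometry.DiscreteGeometry.Hales2012_kissingConfigCongruent → ∀ (h1 : (1 : ℝ) ≠ 0) (hh : Real.sqrt (2 / 3) ≠ 0), (IsLeast (Set.range fun Q : Literature.MathematicalPhysics.StatisticalMechanics.PeriodicConfiguration 3 => Q.energyPerParticle (fun r : ℝ => if r < 1 then M else -(if r = 1 then (1 : ℝ) else 0) - δ * r ^ (-s))) ((Literature.MathematicalPhysics.StatisticalMechanics.hcpPeriodicConfiguration h1 hh).energyPerParticle (fun r : ℝ => if r < 1 then M else -(if r = 1 then (1 : ℝ) else 0) - δ * r ^ (-s))) ∧ Filter.Tendsto (fun N : ℕ => Literature.MathematicalPhysics.StatisticalMechanics.groundStateEnergy (fun r : ℝ => if r < 1 then M else -(if r = 1 then (1 : ℝ) else 0) - δ * r ^ (-s)) 3 N / N) Filter.atTop (nhds ((Literature.MathematicalPhysics.StatisticalMechanics.hcpPeriodicConfiguration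 h1 hh).energyPerParticle (fun r : ℝ => if r < 1 then M else -(if r = 1 then (1 : ℝ) else 0) - δ * r ^ (-s))))) ∧ Literature.MathematicalPhysics.StatisticalMechanics.IsCrystallizing (fun r : ℝ => if r < 1 then M else -(if r = 1 then (1 : ℝ) else 0) - δ * r ^ (-s)) 3

/-- item stmt-AtomisticToContinuum-6162 · crux · rank 2 · closed · moot by None · by planner
why it might fail: Holonomy: a deep region that is not simply connected might close up around an exact 'dislocation loop' with a registry shift (and all-fcc stretches carry 4 layer normals), so no single stacking contains it; the fallback (simply connected pieces) leaks area terms into crux 3.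
sources: Hales2012, HalesDSP2012, HalesEtAl2015, KusnerKusnerLagariasShlosman2018 arXiv:1611.10297, Literature.Barriers.AtomisticToContinuum.FlexibleKissingArrangements
[crux] (card A2, region form) flyspeck_L12 → Hales2012_kissingConfigCongruent → in a 1-separated set
X ⊂ ℝ³, every non-empty contact-connected set G of DEEP points (u deep: u and all its contact
neighbours have exactly 12 contacts) lies in one rigid image g(S) of a Barlow stacking S =
barlowStacking 1 √(2/3) σ, and X agrees with g(S) on the balls B(u, 1.26), u ∈ G. [difficulty: L] -/
@[route_item "route-AtomisticToContinuum-AdhesiveTailRung"]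
def BarlowRegionEmbedding : Prop :=
  Literature.Geometry.DiscreteGeometry.flyspeck_L12 → Literature.Geometry.DiscreteGeometry.Hales2012_kissingConfigCongruent → ∀ X G : Set (EuclideanSpace ℝ (Fin 3)), (∀ x ∈ X, ∀ y ∈ X, x ≠ y → 1 ≤ dist x y) → G ⊆ X → G.Nonempty → (∀ u ∈ G, ∀ v ∈ X, dist u v ≤ 1 → {y ∈ X | dist v y = 1}.ncard = 12) → (∀ u ∈ G, ∀ v ∈ G, Relation.ReflTransGen (fun p q : EuclideanSpace ℝ (Fin 3) => p ∈ G ∧ q ∈ G ∧ dist p q = 1) u v) → ∃ σ : ℤ → ℤ, Literature.MathematicalPhysics.StatisticalMechanics.IsHaggSeq σ ∧ ∃ g : EuclideanSpace ℝ (Fin 3) ≃ᵢ EuclideanSpace ℝ (Fin 3), ∀ u ∈ G, ∀ y : EuclideanSpace ℝ (Fin 3), dist u y < Literature.Geometry.DiscreteGeometry.hales_h0 → (y ∈ X ↔ y ∈ g '' Literature.MathematicalPhysics.StatisticalMechanics.barlowStacking 1 (Real.sqrt (2 / 3)) σ)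

/-- item stmt-AtomisticToContinuum-6163 · crux · rank 3 · closed · moot by None · by planner
why it might fail: No δN/log N leak only if deep regions embed in ONE stacking (crux 2) and every cross pair's segment passes within 3 of a non-deep point; ball-by-ball charts provably lose Σ_k k²·k^{3−s} = log N at s = 6, so the region form is essential, not cosmetic.
sources: Radin1981, KubinPonsiglione2021, BeterminPetrache2017, BlancLewin2015 arXiv:1504.01153 §2.3
[crux] (card A3, the new engine) for s > 4, granting the two Hales facts, there is C(s) with
Σ_{x≠y∈X} |x−y|^{−s} ≤ ζ_hcp(s)·|X| + C·#{non-deep points} for every finite 1-separated X ⊂ ℝ³,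
ζ_hcp(s) = Σ_{y∈hcp∖0} ‖y‖^{−s} (contact 1): internal pairs of a deep region by extension comparison
in its stacking (crux 2) + per-site hcp optimality (crux 4); cross pairs charged to a non-deep point
within 3 of the segment (routing walk + SegmentChargingBound). [deps: BarlowRegionEmbedding,
PerSiteHcpOptimality, SegmentChargingBound] [difficulty: L] -/
@[route_item "route-AtomisticToContinuum-AdhesiveTailRung"]
def TruncationFreeTailBound : Prop :=
  ∀ s : ℝ, 4 < s → Literature.Geometry.DiscreteGeometry.flyspeck_L12 → Literature.Geometry.DiscreteGeometry.Hales2012_kissingConfigCongruent → ∃ C : ℝ, ∀ X : Finset (EuclideanSpace ℝ (Fin 3)), (∀ x ∈ X, ∀ y ∈ X, x ≠ y → 1 ≤ dist x y) → (∑ x ∈ X, ∑ y ∈ X, if x = y then (0 : ℝ) else dist x y ^ (-s)) ≤ (∑' y : {y : EuclideanSpace ℝ (Fin 3) // y ∈ Literature.MathematicalPhysics.StatisticalMechanics.hcpStacking 1 (Real.sqrt (2 / 3)) ∧ y ≠ 0}, ‖(y : EuclideanSpace ℝ (Fin 3))‖ ^ (-s)) * X.card + C * ((X.filter fun u => ∃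 v ∈ X, dist u v ≤ 1 ∧ (X.filter fun y => dist v y = 1).card ≠ 12).card : ℝ)

/-- item stmt-AtomisticToContinuum-6164 · crux · rank 4 · closed · moot by None · by planner
why it might fail: Claimed for ALL (a,h), not only contact geometry, with a STRICT gap γ = g(2h) − g(3h): needs θ_Λ(α) − θ_{Λ+w}(α) > 0 for every α (Poisson; Mathlib has only 1-D theta transforms); as typed it compares tsums whose summability (s > 3) must be threaded or junk zeros are compared.
sources: BeterminPetrache2017 arXiv:1607.08716 Prop. 1.1 and Step 2.3, KiharaKoba1952, BeterminSamajTravenec2022, Literature.MathematicalPhysics.StatisticalMechanics.barlowCoupling (BarlowStackingEnergy.lean)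
[crux] (card A4) for s > 3 and ALL spacings a, h > 0 there is γ > 0 such that for every Hägg
sequence σ and every site z of barlowStacking a h σ: Σ_{y∈S∖z} |y−z|^{−s} ≤ ζ_hcp(a,h,s), and ≤
ζ_hcp − γ unless the layers two above and two below z are aligned with z's layer (h-letters on both
sides) — aligned-minus-staggered layer sums g(kh) > 0 strictly decreasing (θ_Λ > θ_{Λ+w} by Poisson,
Bernstein in t²) + monotone pairing k_j ≥ 2j. [difficulty: L] -/
@[route_item "route-AtomisticToContinuum-AdhesiveTailRung"]
def PerSiteHcpOptimality : Prop :=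
  ∀ s : ℝ, 3 < s → ∀ a h : ℝ, 0 < a → 0 < h → ∃ γ : ℝ, 0 < γ ∧ ∀ σ : ℤ → ℤ, Literature.MathematicalPhysics.StatisticalMechanics.IsHaggSeq σ → ∀ m i j : ℤ, (∑' y : {y : EuclideanSpace ℝ (Fin 3) // y ∈ Literature.MathematicalPhysics.StatisticalMechanics.barlowStacking a h σ ∧ y ≠ Literature.MathematicalPhysics.StatisticalMechanics.barlowPos a h σ m i j}, dist (Literature.MathematicalPhysics.StatisticalMechanics.barlowPos a h σ m i j) y ^ (-s)) ≤ (∑' y : {y : EuclideanSpace ℝ (Fin 3) // y ∈ Literature.MathematicalPhysics.StatisticalMechanics.hcpStacking a h ∧ y ≠ 0}, ‖(y : EuclideanSpace ℝ (Fin 3))‖ ^ (-s)) ∧ (¬ (Literature.MathematicalPhysics.StatisticalMechanics.HaggAligned σ m 2 ∧ Literature.MathematicalPhysics.StatisticalMechanics.HaggAligned σ (m - 2) 2) → (∑' y : {y : EuclideanSpace ℝ (Fin 3) // y ∈ Literature.MathematicalPhysics.StatisticalMechanics.barlowStacking a h σ ∧ y ≠ Literature.MathematicalPhysics.StatisticalMechanics.barlowPos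 a h σ m i j}, dist (Literature.MathematicalPhysics.StatisticalMechanics.barlowPos a h σ m i j) y ^ (-s)) ≤ (∑' y : {y : EuclideanSpace ℝ (Fin 3) // y ∈ Literature.MathematicalPhysics.StatisticalMechanics.hcpStacking a h ∧ y ≠ 0}, ‖(y : EuclideanSpace ℝ (Fin 3))‖ ^ (-s)) - γ)

/-- item stmt-AtomisticToContinuum-6165 · crux · rank 5 · closed · moot by None · by planner
why it might fail: Here a δN leak would surface: if cross-interface tail mass is not O(#non-deep) (crux 2 or the routing false) the best bound is E(N) ≥ N e(hcp) − CδN and the hinge dies; also needs energyPerParticle(hcp) identified with the layer sums (regrouping, cf. BarlowEnergyIdentification).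
sources: HeitmannRadin1980, Radin1981, Bezdek2012, BlancLewin2015, Harborth1974
[crux] for s > 4, 0 < δ < δ₀(s), M ≥ M₀, granting the Hales facts: |E_V(N) −
N·e_V(hcpPeriodicConfiguration 1 √(2/3))| ≤ K N^{2/3} for all N (lower bound: packing lemma +
kissing ≤ 12 + crux 3 with δ < 1/(13C); upper bound: hcp clusters, whose missing boundary tail is
O(N^{2/3}) again iff s > 4). [deps: TruncationFreeTailBound, GroundStatesArePackings] [difficulty:
M] -/
@[route_item "route-AtomisticToContinuum-AdhesiveTailRung"]
def EnergyTwoSidedBound : Prop :=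
  ∀ s : ℝ, 4 < s → ∃ δ₀ : ℝ, 0 < δ₀ ∧ ∀ δ : ℝ, 0 < δ → δ < δ₀ → ∃ M₀ : ℝ, ∀ M : ℝ, M₀ ≤ M → Literature.Geometry.DiscreteGeometry.flyspeck_L12 → Literature.Geometry.DiscreteGeometry.Hales2012_kissingConfigCongruent → ∀ (h1 : (1 : ℝ) ≠ 0) (hh : Real.sqrt (2 / 3) ≠ 0), ∃ K : ℝ, ∀ N : ℕ, |Literature.MathematicalPhysics.StatisticalMechanics.groundStateEnergy (fun r : ℝ => if r < 1 then M else -(if r = 1 then (1 : ℝ) else 0) - δ * r ^ (-s)) 3 N - N * (Literature.MathematicalPhysics.StatisticalMechanics.hcpPeriodicConfiguration h1 hh).energyPerParticle (fun r : ℝ => if r < 1 then M else -(if r = 1 then (1 : ℝ) else 0) - δ * r ^ (-s))| ≤ K * (N : ℝ) ^ ((2 : ℝ) / 3)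

/-- item stmt-AtomisticToContinuum-6166 · crux · rank 6 · closed · moot by None · by planner
why it might fail: Needs the per-SITE strict gap γδ to price isolated c-layers; if selection only worked per layer PAIR (as for the repulsive twin, fcc) windows would be 'hcp or twinned' and the ∃-window statement fails as typed; also N₀(R) ~ (K(1+1/δγ))³R⁹ — fine but huge.
sources: Radin1981, Hales2012, BeterminPetrache2017, PartayOrtnerCsanyi2017 arXiv:1705.01751, Literature.Barriers.AtomisticToContinuum.KissingTwelveDegeneracy
[crux] for s > 4, 0 < δ < δ₀(s), M ≥ M₀, granting the Hales facts: for every R there is N₀ such that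
every ground state with N ≥ N₀ particles contains a particle x_i and a rigid motion g, g 0 = x_i,
with {particles} ∩ B(x_i, R) = g(hcpStacking 1 √(2/3)) ∩ B(x_i, R) — exact hcp windows (deficiency D
≤ K N^{2/3}, c-letter sites ≤ K N^{2/3}/(δγ) by the strict gap of crux 4, pigeonhole, crux 2 on the
clean ball). [deps: EnergyTwoSidedBound, BarlowRegionEmbedding, PerSiteHcpOptimality] [difficulty:
M] -/
@[route_item "route-AtomisticToContinuum-AdhesiveTailRung"]
def ExactHcpWindows : Prop :=
  ∀ s : ℝ, 4 < s → ∃ δ₀ : ℝ, 0 < δ₀ ∧ ∀ δ : ℝ, 0 < δ → δ < δ₀ → ∃ M₀ : ℝ, ∀ M : ℝ, M₀ ≤ M → Literature.Geometry.DiscreteGeometry.flyspeck_L12 → Literature.Geometry.DiscreteGeometry.Hales2012_kissingConfigCongruent → ∀ R : ℝ, ∃ N₀ : ℕ, ∀ N : ℕ, N₀ ≤ N → ∀ x : Fin N → EuclideanSpace ℝ (Fin 3), Literature.MathematicalPhysics.StatisticalMechanics.IsGroundState (fun r : ℝ => if r < 1 then M else -(if r = 1 then (1 : ℝ) else 0)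 - δ * r ^ (-s)) x → ∃ i : Fin N, ∃ g : EuclideanSpace ℝ (Fin 3) ≃ᵢ EuclideanSpace ℝ (Fin 3), g 0 = x i ∧ ∀ y : EuclideanSpace ℝ (Fin 3), dist y (x i) ≤ R → (y ∈ Set.range x ↔ y ∈ g '' Literature.MathematicalPhysics.StatisticalMechanics.hcpStacking 1 (Real.sqrt (2 / 3)))

/-- item stmt-AtomisticToContinuum-6167 · support · rank 9 · closed · moot by None · by planner
sources: HeitmannRadin1980, BlancLewin2015 §1.2–1.3, Literature.MathematicalPhysics.StatisticalMechanics.StickyChain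
[support] (card A1) for s > 3, 0 ≤ δ ≤ 1 there is M₀ (≈ 18 + 2δ Z′_s) such that for M ≥ M₀, granting
flyspeck_L12 (kissing ≤ 12), every ground state of V_{s,δ,M} has all mutual distances ≥ 1: thin a
configuration to a maximal packing sub-configuration Y; each removed particle costs ≥ M − 12 − δZ′
against Y, the removed set has energy ≥ −(6 + δZ′/2)·# by induction (stability), and E(N) is
non-increasing in N. [difficulty: provable-now] -/
@[route_item "route-AtomisticToContinuum-AdhesiveTailRung"]
def GroundStatesArePackings : Prop :=
  ∀ s : ℝ, 3 < s → ∀ δ : ℝ, 0 ≤ δ → δ ≤ 1 → ∃ M₀ : ℝ, ∀ M : ℝ, M₀ ≤ M → Literature.Geometry.DiscreteGeometry.flyspeck_L12 → ∀ (N : ℕ) (x : Fin N → EuclideanSpace ℝ (Fin 3)), Literature.MathematicalPhysics.StatisticalMechanics.IsGroundState (fun r : ℝ => if r < 1 then M else -(if r = 1 then (1 : ℝ) else 0) - δ * r ^ (-s)) x → ∀ i j : Fin N, i ≠ j → 1 ≤ dist (x i) (x j)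

/-- item stmt-AtomisticToContinuum-6168 · support · rank 9 · closed · moot by None · by planner
sources: KubinPonsiglione2021, BlancLewin2015, Literature.MathematicalPhysics.StatisticalMechanics.card_le_of_separated_of_dist_le
[support] (card A3b, analytic half) for s > 4 there is C(s) such that for every finite 1-separated X
⊂ ℝ³ and every point p, the total weight |x−y|^{−s} of ordered pairs of X whose segment passes
within distance 3 of p is ≤ C (pairs at combined distance u from p number O(u³) by volume packing,
LennardJonesClusters.card_le_of_separated_of_dist_le; Σ_u u³·u^{−s} < ∞ iff s > 4). [difficulty:
provable-now] -/
@[route_item "route-AtomisticToContinuum-AdhesiveTailRung"]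
def SegmentChargingBound : Prop :=
  ∀ s : ℝ, 4 < s → ∃ C : ℝ, ∀ X : Finset (EuclideanSpace ℝ (Fin 3)), (∀ x ∈ X, ∀ y ∈ X, x ≠ y → 1 ≤ dist x y) → ∀ p : EuclideanSpace ℝ (Fin 3), (∑ x ∈ X, ∑ y ∈ X, if x ≠ y ∧ (∃ t : ℝ, 0 ≤ t ∧ t ≤ 1 ∧ dist (x + t • (y - x)) p ≤ 3) then dist x y ^ (-s) else (0 : ℝ)) ≤ C

/-- item stmt-AtomisticToContinuum-6169 · support · rank 9 · closed · moot by None · by planner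
sources: BlancLewin2015 §2.1 (16), Literature.MathematicalPhysics.StatisticalMechanics.PeriodicConfiguration.tendsto_sum_of_eventually_near', Literature.MathematicalPhysics.StatisticalMechanics.PeriodicConfiguration.isometryImage
[support] (card A5) for any potential V whose ground states are 1-separated, exact hcp windows of
every radius in all large ground states imply IsCrystallizing V 3: centre at the window, extract a
convergent subsequence of the rotations in O(3), limit P = isometryImage A (hcpPeriodicConfiguration
1 √(2/3)), m ≡ 1, convergence by CrystallizationLocalLimit.tendsto_sum_of_eventually_near'.
[difficulty: provable-now] -/
@[route_item "route-AtomisticToContinuum-AdhesiveTailRung"]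
def WindowsCrystallize : Prop :=
  ∀ V : ℝ → ℝ, (∀ (N : ℕ) (x : Fin N → EuclideanSpace ℝ (Fin 3)), Literature.MathematicalPhysics.StatisticalMechanics.IsGroundState V x → ∀ i j : Fin N, i ≠ j → 1 ≤ dist (x i) (x j)) → (∀ R : ℝ, ∃ N₀ : ℕ, ∀ N : ℕ, N₀ ≤ N → ∀ x : Fin N → EuclideanSpace ℝ (Fin 3), Literature.MathematicalPhysics.StatisticalMechanics.IsGroundState V x → ∃ i : Fin N, ∃ g : EuclideanSpace ℝ (Fin 3) ≃ᵢ EuclideanSpace ℝ (Fin 3), g 0 = x i ∧ ∀ y : EuclideanSpace ℝ (Fin 3), dist y (x i) ≤ R → (y ∈ Set.range x ↔ y ∈ g '' Literature.MathematicalPhysics.StatisticalMechanics.hcpStacking 1 (Real.sqrt (2 / 3)))) → Literature.MathematicalPhysics.StatisticalMechanics.IsCrystallizing V 3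

/-- item stmt-AtomisticToContinuum-6170 · support · rank 9 · closed · moot by None · by planner
sources: BlancLewin2015 §1.3 (8)–(9) and §2.1, Literature.MathematicalPhysics.StatisticalMechanics.PeriodicConfigurationSums
[support] periodic trial states: for s > 3, δ ≥ 0, M ≥ 0 and every periodic configuration Q of ℝ³,
eventually E_V(N)/N ≤ e_V(Q) + ε (boxes of Q; cross-boundary terms are either +M, dropped in the
right direction, or an absolutely summable tail o(N); surplus particles deleted at cost o(N)).
[difficulty: provable-now] -/
@[route_item "route-AtomisticToContinuum-AdhesiveTailRung"]
def PeriodicUpperBound : Prop :=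
  ∀ s δ M : ℝ, 3 < s → 0 ≤ δ → 0 ≤ M → ∀ Q : Literature.MathematicalPhysics.StatisticalMechanics.PeriodicConfiguration 3, ∀ ε : ℝ, 0 < ε → ∀ᶠ N : ℕ in Filter.atTop, Literature.MathematicalPhysics.StatisticalMechanics.groundStateEnergy (fun r : ℝ => if r < 1 then M else -(if r = 1 then (1 : ℝ) else 0) - δ * r ^ (-s)) 3 N / N ≤ Q.energyPerParticle (fun r : ℝ => if r < 1 then M else -(if r = 1 then (1 : ℝ) else 0) - δ * r ^ (-s)) + ε

/-- item stmt-AtomisticToContinuum-6171 · support · rank 9 · closed · moot by None · by planner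
sources: BlancLewin2015
[support] glue of the rung: GroundStatesArePackings → EnergyTwoSidedBound → ExactHcpWindows →
WindowsCrystallize → PeriodicUpperBound → AdhesiveTailCrystallizes (take δ₀ = min, M₀ = max; IsLeast
from e(hcp) − K N^{−1/3} ≤ E(N)/N ≤ e(Q) + ε; Tendsto by squeeze with Q = hcp; IsCrystallizing from
the windows). [difficulty: provable-now] -/
@[route_item "route-AtomisticToContinuum-AdhesiveTailRung"]
def RungGlue : Prop :=
  GroundStatesArePackings → EnergyTwoSidedBound → ExactHcpWindows → WindowsCrystallize → PeriodicUpperBound → AdhesiveTailCrystallizes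

/-- item stmt-AtomisticToContinuum-6172 · support · rank 9 · closed · moot by None · by planner
sources: BlancLewin2015 §2.3, Literature.Barriers.AtomisticToContinuum.LocalizedPotentialsExcludeLennardJones
[support] OPEN BRIDGE, NOT CLAIMED (rung route; this item is the honest gap, cf. CMRescueSzpiro's
rung pattern): the rung implies the Lennard-Jones conjunct. No mechanism is asserted — LJ sits at
well width O(1) and tail weight 2 in well units, far outside δ < δ₀, and continuation in the
potential (card potential-path-continuation) was retired for finite reach; the item records the gap
honestly so that the Assembly typechecks to the summit constant. Difficulty: open-problem; not to be
staffed. [difficulty: open-problem] -/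
@[route_item "route-AtomisticToContinuum-AdhesiveTailRung"]
def AdhesiveToLennardJones : Prop :=
  AdhesiveTailCrystallizes → Literature.MathematicalPhysics.StatisticalMechanics.Crystallization

/-- item stmt-AtomisticToContinuum-6173 · assembly · rank 1 · closed · moot by None · by planner
sources: BlancLewin2015, Radin1981
[assembly] AdhesiveTailCrystallizes → AdhesiveToLennardJones → Crystallization. -/
@[route_item "route-AtomisticToContinuum-AdhesiveTailRung"]
def Assembly : Prop :=
  AdhesiveTailCrystallizes → AdhesiveToLennardJones → Literature.MathematicalPhysics.StatisticalMechanics.Crystallization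

end Summit.AtomisticToContinuum.Crystallization.Theses.AdhesiveTailRung
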